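import Summits.AtomisticToContinuum.FouriersLaw.Theorems.OddSectorIrreversibilityResponseDensityEnergyEstimate

/-!
# The energy estimate with the energy cutoffs `χ_R`: constants uniform in `R ≥ 1`

Helper file for item stmt-AtomisticToContinuum-9144 (`ResponseDensity`, route
`OddSectorIrreversibility`, sub-problem `FouriersLaw` of `AtomisticToContinuum`), part of the
detailed-balance (hDUAL) line. Both baths at temperature `T > 0`, `π = e^{-H/T}`,
`χ_R = χ(H/R)`, `Γ = carreDuChamp v_L v_R`:

* `pinnedChain_gibbs_mul_momentSq_le`, `pinnedChain_integrable_gibbs_mul_momentSq` —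
  `π (p_0² + p_{N-1}²) ≤ 8T e^{-H/(2T)}` is integrable;
* `pinnedChain_integral_gibbs_carreDuChamp_cutoff_le` — `∫ π Γ(χ_R) dx ≤ C₁ / R²`;
* `pinnedChain_integral_gibbs_abs_generator_cutoff_le` — `∫ π |L χ_R| dx ≤ C₂ / R` (`R ≥ 1`);
* `pinnedChain_integral_gibbs_cutoffWeight_le` — `∫ π |8Γ(χ_R) - L(χ_R²)| dx ≤ D` (`R ≥ 1`);
* `pinnedChain_energy_estimate_cutoff` — **for `F ∈ C_c^∞` there is `C` with
  `∫_{s₀}^{s₁} ∫ π χ_R² Γ(P_s F) dx ds ≤ C (1 + (s₁ - s₀))` for all `R ≥ 1`, `0 < s₀ ≤ s₁`**.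

No definitions.
-/

noncomputable section

open MeasureTheory ProbabilityTheory Filter Topology Set Function Metric
open scoped NNReal ENNReal ContDiff

namespace Summit.AtomisticToContinuum.FouriersLaw.Theorems

open Literature.MathematicalPhysics.KineticTheory.HeatConduction
open Literature.Probability.Process Literature.MathematicalPhysics.KineticTheory OscillatorChain

variable {N : ℕ}

section Weights

variable {ω₂ lam β γ : ℝ} (hω : 0 < ω₂) (hl : 0 ≤ lam) (hβ : 0 ≤ β) (hγ : 0 < γ) (hN : 0 < N)
  {T : ℝ} (hT : 0 < T)
include hω hl hβ hγ hN hT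

omit hω hl hβ hγ hN in
/-- `h e^{-h/T} ≤ 2T e^{-h/(2T)}`. -/
theorem mul_exp_neg_div_le_two_mul (h : ℝ) :
    h * Real.exp (-h / T) ≤ 2 * T * Real.exp (-(1 / (2 * T) * h)) := by
  have h1 : h / (2 * T) + 1 ≤ Real.exp (h / (2 * T)) := Real.add_one_le_exp _
  have h2 : h ≤ 2 * T * Real.exp (h / (2 * T)) := by
    have : h / (2 * T) ≤ Real.exp (h / (2 * T)) := by linarith
    rwa [div_le_iff₀ (by positivity), mul_comm] at this
  have h3 : Real.exp (-h / T) = Real.exp (-(1 / (2 * T) * h)) * Real.exp (-(h / (2 * T))) := by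
    rw [← Real.exp_add]; congr 1; field_simp; ring
  rw [h3]
  have h4 : Real.exp (h / (2 * T)) * Real.exp (-(h / (2 * T))) = 1 := by
    rw [← Real.exp_add, add_neg_cancel, Real.exp_zero]
  calc h * (Real.exp (-(1 / (2 * T) * h)) * Real.exp (-(h / (2 * T)))) ≤
      (2 * T * Real.exp (h / (2 * T))) * (Real.exp (-(1 / (2 * T) * h)) * Real.exp (-(h / (2 * T)))) :=
        mul_le_mul_of_nonneg_right h2 (by positivity)
    _ = 2 * T * Real.exp (-(1 / (2 * T) * h)) * (Real.exp (h / (2 * T)) * Real.exp (-(h / (2 * T)))) := by ring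
    _ = _ := by rw [h4, mul_one]

/-- **`π (p_0² + p_{N-1}²) ≤ 8T e^{-H/(2T)}`** (`p_0² + p_{N-1}² ≤ 4H`, `H e^{-H/T} ≤ 2T e^{-H/2T}`). -/
theorem pinnedChain_gibbs_mul_momentSq_le (x : PhaseSpace N) :
    (pinnedChain ω₂ lam β γ).gibbsDensity N T x * (x.2 ⟨0, hN⟩ ^ 2 + x.2 ⟨N - 1, by omega⟩ ^ 2) ≤
      8 * T * Real.exp (-(1 / (2 * T) * (pinnedChain ω₂ lam β γ).hamiltonian N x)) := by
  have hPc : (pinnedChain ω₂ lam β γ).IsConfining := SubdiffusiveBondHeat.pinnedChain_isConfining hω hl hβ hγ.le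
  have hsum := (pinnedChain ω₂ lam β γ).sum_sq_momentum_le hPc.U_nonneg hPc.V_nonneg N x
  have h0 : x.2 ⟨0, hN⟩ ^ 2 ≤ ∑ i, x.2 i ^ 2 :=
    Finset.single_le_sum (f := fun i => x.2 i ^ 2) (fun i _ => sq_nonneg _) (Finset.mem_univ _)
  have h1 : x.2 ⟨N - 1, by omega⟩ ^ 2 ≤ ∑ i, x.2 i ^ 2 :=
    Finset.single_le_sum (f := fun i => x.2 i ^ 2) (fun i _ => sq_nonneg _) (Finset.mem_univ _)
  have hH0 : 0 ≤ (pinnedChain ω₂ lam β γ).hamiltonian N x := pinnedChain_hamiltonian_nonneg hω.le hl hβ γ N x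
  have h4 : x.2 ⟨0, hN⟩ ^ 2 + x.2 ⟨N - 1, by omega⟩ ^ 2 ≤ 4 * (pinnedChain ω₂ lam β γ).hamiltonian N x := by
    linarith
  have hπ0 : 0 < (pinnedChain ω₂ lam β γ).gibbsDensity N T x := (pinnedChain ω₂ lam β γ).gibbsDensity_pos N T x
  have hm := mul_exp_neg_div_le_two_mul hT ((pinnedChain ω₂ lam β γ).hamiltonian N x)
  calc _ ≤ (pinnedChain ω₂ lam β γ).gibbsDensity N T x * (4 * (pinnedChain ω₂ lam β γ).hamiltonian N x) :=
        mul_le_mul_of_nonneg_left h4 hπ0.le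
    _ = 4 * ((pinnedChain ω₂ lam β γ).hamiltonian N x * Real.exp (-(pinnedChain ω₂ lam β γ).hamiltonian N x / T)) := by
        simp only [OscillatorChain.gibbsDensity]; ring
    _ ≤ 4 * (2 * T * Real.exp (-(1 / (2 * T) * (pinnedChain ω₂ lam β γ).hamiltonian N x))) :=
        mul_le_mul_of_nonneg_left hm (by norm_num)
    _ = _ := by ring

/-- `π (p_0² + p_{N-1}²)` is integrable. -/
theorem pinnedChain_integrable_gibbs_mul_momentSq :
    Integrable fun x : PhaseSpace N =>
      (pinnedChain ω₂ lam β γ).gibbsDensity N T x * (x.2 ⟨0, hN⟩ ^ 2 + x.2 ⟨N - 1, by omega⟩ ^ 2) := by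
  have hI := (pinnedChain_integrable_exp_neg_mul_hamiltonian hω hl hβ γ N (c := 1 / (2 * T)) (by positivity)).const_mul (8 * T)
  have hπc : Continuous ((pinnedChain ω₂ lam β γ).gibbsDensity N T) :=
    Real.continuous_exp.comp (((pinnedChain_contDiff_hamiltonian ω₂ lam β γ N (n := 0)).continuous).neg.div_const T)
  refine hI.mono' ((hπc.mul (by fun_prop)).aestronglyMeasurable) (Eventually.of_forall fun x => ?_)
  rw [Real.norm_eq_abs, abs_of_nonneg (mul_nonneg ((pinnedChain ω₂ lam β γ).gibbsDensity_pos N T x).le (by positivity))]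
  exact pinnedChain_gibbs_mul_momentSq_le hω hl hβ hγ hN hT x

/-- **`∫ π Γ(χ_R) dx ≤ C₁ / R²`**. -/
theorem pinnedChain_integral_gibbs_carreDuChamp_cutoff_le :
    ∃ C₁ : ℝ, 0 ≤ C₁ ∧ ∀ R : ℝ, 0 < R →
      ∫ x, (pinnedChain ω₂ lam β γ).gibbsDensity N T x *
        carreDuChamp ((pinnedChain ω₂ lam β γ).bathVecL N T) ((pinnedChain ω₂ lam β γ).bathVecR N T)
          (fun y => smoothCutoff ((pinnedChain ω₂ lam β γ).hamiltonian N y / R))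
          (fun y => smoothCutoff ((pinnedChain ω₂ lam β γ).hamiltonian N y / R)) x ≤ C₁ / R ^ 2 := by
  obtain ⟨S₁, hS₁0, hS₁⟩ := exists_bound_deriv_smoothCutoff
  have hγT : 0 ≤ 2 * γ * T := by positivity
  set M := ∫ x, (pinnedChain ω₂ lam β γ).gibbsDensity N T x * (x.2 ⟨0, hN⟩ ^ 2 + x.2 ⟨N - 1, by omega⟩ ^ 2) with hM
  have hM0 : 0 ≤ M := integral_nonneg fun x =>
    mul_nonneg ((pinnedChain ω₂ lam β γ).gibbsDensity_pos N T x).le (by positivity)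
  refine ⟨S₁ ^ 2 * (2 * γ * T) * M, mul_nonneg (by positivity) hM0, fun R hR => ?_⟩
  have hI := pinnedChain_integrable_gibbs_mul_momentSq hω hl hβ hγ hN hT
  calc _ ≤ ∫ x, (pinnedChain ω₂ lam β γ).gibbsDensity N T x *
        (S₁ ^ 2 / R ^ 2 * (2 * γ * T * (x.2 ⟨0, hN⟩ ^ 2 + x.2 ⟨N - 1, by omega⟩ ^ 2))) := by
        refine integral_mono_of_nonneg (Eventually.of_forall fun x => mul_nonneg
          ((pinnedChain ω₂ lam β γ).gibbsDensity_pos N T x).le (carreDuChamp_self_nonneg _ _ _ _)) ?_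
          (Eventually.of_forall fun x => mul_le_mul_of_nonneg_left
            (pinnedChain_carreDuChamp_cutoff_le N hN hγT hS₁ hR x) ((pinnedChain ω₂ lam β γ).gibbsDensity_pos N T x).le)
        have e : (fun x : PhaseSpace N => (pinnedChain ω₂ lam β γ).gibbsDensity N T x *
            (S₁ ^ 2 / R ^ 2 * (2 * γ * T * (x.2 ⟨0, hN⟩ ^ 2 + x.2 ⟨N - 1, by omega⟩ ^ 2)))) =
            fun x => (S₁ ^ 2 / R ^ 2 * (2 * γ * T)) * ((pinnedChain ω₂ lam β γ).gibbsDensity N T x *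
              (x.2 ⟨0, hN⟩ ^ 2 + x.2 ⟨N - 1, by omega⟩ ^ 2)) := funext fun x => by ring
        rw [e]; exact hI.const_mul _
    _ = S₁ ^ 2 / R ^ 2 * (2 * γ * T) * M := by
        rw [hM, ← integral_const_mul]
        exact integral_congr_ae (Eventually.of_forall fun x => by ring)
    _ = _ := by field_simp

/-- **`∫ π |L χ_R| dx ≤ C₂ / R`** for `R ≥ 1`. -/
theorem pinnedChain_integral_gibbs_abs_generator_cutoff_le :
    ∃ C₂ : ℝ, 0 ≤ C₂ ∧ ∀ R : ℝ, 1 ≤ R →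
      ∫ x, (pinnedChain ω₂ lam β γ).gibbsDensity N T x *
        |(pinnedChain ω₂ lam β γ).generator N T T
          (fun y => smoothCutoff ((pinnedChain ω₂ lam β γ).hamiltonian N y / R)) x| ≤ C₂ / R := by
  obtain ⟨S₁, hS₁0, hS₁⟩ := exists_bound_deriv_smoothCutoff
  obtain ⟨S₂, hS₂0, hS₂⟩ := exists_bound_deriv_deriv_smoothCutoff
  set M := ∫ x, (pinnedChain ω₂ lam β γ).gibbsDensity N T x * (x.2 ⟨0, hN⟩ ^ 2 + x.2 ⟨N - 1, by omega⟩ ^ 2) with hM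
  set Z := ∫ x, (pinnedChain ω₂ lam β γ).gibbsDensity N T x with hZ
  have hM0 : 0 ≤ M := integral_nonneg fun x =>
    mul_nonneg ((pinnedChain ω₂ lam β γ).gibbsDensity_pos N T x).le (by positivity)
  have hZ0 : 0 ≤ Z := integral_nonneg fun x => ((pinnedChain ω₂ lam β γ).gibbsDensity_pos N T x).le
  have hI := pinnedChain_integrable_gibbs_mul_momentSq hω hl hβ hγ hN hT
  have hIπ := pinnedChain_integrable_gibbsDensity hω hl hβ γ N hT
  refine ⟨γ * (T * S₂ + S₁) * M + 2 * γ * T * S₁ * Z,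
    add_nonneg (mul_nonneg (by positivity) hM0) (mul_nonneg (by positivity) hZ0), fun R hR => ?_⟩
  have hR0 : 0 < R := by linarith
  calc _ ≤ ∫ x, (pinnedChain ω₂ lam β γ).gibbsDensity N T x *
        ((γ * (T * S₂ + S₁) * (x.2 ⟨0, hN⟩ ^ 2 + x.2 ⟨N - 1, by omega⟩ ^ 2) + 2 * γ * T * S₁) / R) := by
        refine integral_mono_of_nonneg (Eventually.of_forall fun x => mul_nonneg
          ((pinnedChain ω₂ lam β γ).gibbsDensity_pos N T x).le (abs_nonneg _)) ?_
          (Eventually.of_forall fun x => mul_le_mul_of_nonneg_left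
            (pinnedChain_abs_generator_cutoff_le N hN hγ.le hT.le hS₁ hS₂ hR x)
            ((pinnedChain ω₂ lam β γ).gibbsDensity_pos N T x).le)
        have e : (fun x : PhaseSpace N => (pinnedChain ω₂ lam β γ).gibbsDensity N T x *
            ((γ * (T * S₂ + S₁) * (x.2 ⟨0, hN⟩ ^ 2 + x.2 ⟨N - 1, by omega⟩ ^ 2) + 2 * γ * T * S₁) / R)) =
            fun x => (γ * (T * S₂ + S₁) / R) * ((pinnedChain ω₂ lam β γ).gibbsDensity N T x *
              (x.2 ⟨0, hN⟩ ^ 2 + x.2 ⟨N - 1, by omega⟩ ^ 2)) +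
              (2 * γ * T * S₁ / R) * (pinnedChain ω₂ lam β γ).gibbsDensity N T x := funext fun x => by ring
        rw [e]; exact (hI.const_mul _).add (hIπ.const_mul _)
    _ = (γ * (T * S₂ + S₁) / R) * M + (2 * γ * T * S₁ / R) * Z := by
        rw [hM, hZ, ← integral_const_mul, ← integral_const_mul, ← integral_add (hI.const_mul _) (hIπ.const_mul _)]
        exact integral_congr_ae (Eventually.of_forall fun x => by ring)
    _ = _ := by field_simp

/-- **`∫ π |8Γ(χ_R) - L(χ_R²)| dx ≤ D`** for `R ≥ 1`. -/
theorem pinnedChain_integral_gibbs_cutoffWeight_le :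
    ∃ D : ℝ, 0 ≤ D ∧ ∀ R : ℝ, 1 ≤ R →
      ∫ x, (pinnedChain ω₂ lam β γ).gibbsDensity N T x *
        |8 * carreDuChamp ((pinnedChain ω₂ lam β γ).bathVecL N T) ((pinnedChain ω₂ lam β γ).bathVecR N T)
            (fun y => smoothCutoff ((pinnedChain ω₂ lam β γ).hamiltonian N y / R))
            (fun y => smoothCutoff ((pinnedChain ω₂ lam β γ).hamiltonian N y / R)) x -
          (pinnedChain ω₂ lam β γ).generator N T T
            (fun y => smoothCutoff ((pinnedChain ω₂ lam β γ).hamiltonian N y / R) ^ 2) x| ≤ D := by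
  obtain ⟨S₁, hS₁0, hS₁⟩ := exists_bound_deriv_smoothCutoff
  obtain ⟨S₂, hS₂0, hS₂⟩ := exists_bound_deriv_deriv_smoothCutoff
  set M := ∫ x, (pinnedChain ω₂ lam β γ).gibbsDensity N T x * (x.2 ⟨0, hN⟩ ^ 2 + x.2 ⟨N - 1, by omega⟩ ^ 2) with hM
  set Z := ∫ x, (pinnedChain ω₂ lam β γ).gibbsDensity N T x with hZ
  have hM0 : 0 ≤ M := integral_nonneg fun x =>
    mul_nonneg ((pinnedChain ω₂ lam β γ).gibbsDensity_pos N T x).le (by positivity)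
  have hZ0 : 0 ≤ Z := integral_nonneg fun x => ((pinnedChain ω₂ lam β γ).gibbsDensity_pos N T x).le
  have hI := pinnedChain_integrable_gibbs_mul_momentSq hω hl hβ hγ hN hT
  have hIπ := pinnedChain_integrable_gibbsDensity hω hl hβ γ N hT
  have hγT : 0 ≤ 2 * γ * T := by positivity
  -- the pointwise constant
  set A := 8 * (S₁ ^ 2 * (2 * γ * T)) + γ * (T * (2 * (S₁ ^ 2 + S₂)) + 2 * S₁) with hA
  set B := 2 * γ * T * (2 * S₁) with hB
  have hA0 : 0 ≤ A := by rw [hA]; positivity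
  have hB0 : 0 ≤ B := by rw [hB]; positivity
  refine ⟨A * M + B * Z, add_nonneg (mul_nonneg hA0 hM0) (mul_nonneg hB0 hZ0), fun R hR => ?_⟩
  have hR0 : 0 < R := by linarith
  have hpt : ∀ x : PhaseSpace N,
      |8 * carreDuChamp ((pinnedChain ω₂ lam β γ).bathVecL N T) ((pinnedChain ω₂ lam β γ).bathVecR N T)
            (fun y => smoothCutoff ((pinnedChain ω₂ lam β γ).hamiltonian N y / R))
            (fun y => smoothCutoff ((pinnedChain ω₂ lam β γ).hamiltonian N y / R)) x -
          (pinnedChain ω₂ lam β γ).generator N T T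
            (fun y => smoothCutoff ((pinnedChain ω₂ lam β γ).hamiltonian N y / R) ^ 2) x| ≤
        A * (x.2 ⟨0, hN⟩ ^ 2 + x.2 ⟨N - 1, by omega⟩ ^ 2) + B := by
    intro x
    have h1 := pinnedChain_carreDuChamp_cutoff_le N hN hγT hS₁ hR0 x (ω₂ := ω₂) (lam := lam) (β := β)
    have h1' : 0 ≤ carreDuChamp ((pinnedChain ω₂ lam β γ).bathVecL N T) ((pinnedChain ω₂ lam β γ).bathVecR N T)
        (fun y => smoothCutoff ((pinnedChain ω₂ lam β γ).hamiltonian N y / R))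
        (fun y => smoothCutoff ((pinnedChain ω₂ lam β γ).hamiltonian N y / R)) x := carreDuChamp_self_nonneg _ _ _ _
    have h2 := pinnedChain_abs_generator_sqCutoff_le N hN hγ.le hT.le hS₁ hS₂ hR x (ω₂ := ω₂) (lam := lam) (β := β)
    have hm0 : 0 ≤ x.2 ⟨0, hN⟩ ^ 2 + x.2 ⟨N - 1, by omega⟩ ^ 2 := by positivity
    have hR2 : S₁ ^ 2 / R ^ 2 ≤ S₁ ^ 2 := by
      rw [div_le_iff₀ (by positivity)]
      have h1 : 1 ≤ R ^ 2 := by nlinarith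
      nlinarith [mul_le_mul_of_nonneg_left h1 (sq_nonneg S₁)]
    calc _ ≤ |8 * carreDuChamp ((pinnedChain ω₂ lam β γ).bathVecL N T) ((pinnedChain ω₂ lam β γ).bathVecR N T)
            (fun y => smoothCutoff ((pinnedChain ω₂ lam β γ).hamiltonian N y / R))
            (fun y => smoothCutoff ((pinnedChain ω₂ lam β γ).hamiltonian N y / R)) x| +
          |(pinnedChain ω₂ lam β γ).generator N T T
            (fun y => smoothCutoff ((pinnedChain ω₂ lam β γ).hamiltonian N y / R) ^ 2) x| := abs_sub _ _
      _ ≤ 8 * (S₁ ^ 2 * (2 * γ * T * (x.2 ⟨0, hN⟩ ^ 2 + x.2 ⟨N - 1, by omega⟩ ^ 2))) +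
          (γ * (T * (2 * (S₁ ^ 2 + S₂)) + 2 * S₁) * (x.2 ⟨0, hN⟩ ^ 2 + x.2 ⟨N - 1, by omega⟩ ^ 2) +
            2 * γ * T * (2 * S₁)) := by
          refine add_le_add ?_ h2
          rw [abs_mul, abs_of_pos (by norm_num : (0:ℝ) < 8), abs_of_nonneg h1']
          refine mul_le_mul_of_nonneg_left (h1.trans ?_) (by norm_num)
          exact mul_le_mul_of_nonneg_right hR2 (by positivity)
      _ = _ := by rw [hA, hB]; ring
  calc _ ≤ ∫ x, (pinnedChain ω₂ lam β γ).gibbsDensity N T x * (A * (x.2 ⟨0, hN⟩ ^ 2 + x.2 ⟨N - 1, by omega⟩ ^ 2) + B) := by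
        refine integral_mono_of_nonneg (Eventually.of_forall fun x => mul_nonneg
          ((pinnedChain ω₂ lam β γ).gibbsDensity_pos N T x).le (abs_nonneg _)) ?_
          (Eventually.of_forall fun x => mul_le_mul_of_nonneg_left (hpt x) ((pinnedChain ω₂ lam β γ).gibbsDensity_pos N T x).le)
        have e : (fun x : PhaseSpace N => (pinnedChain ω₂ lam β γ).gibbsDensity N T x *
            (A * (x.2 ⟨0, hN⟩ ^ 2 + x.2 ⟨N - 1, by omega⟩ ^ 2) + B)) =
            fun x => A * ((pinnedChain ω₂ lam β γ).gibbsDensity N T x * (x.2 ⟨0, hN⟩ ^ 2 + x.2 ⟨N - 1, by omega⟩ ^ 2)) +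
              B * (pinnedChain ω₂ lam β γ).gibbsDensity N T x := funext fun x => by ring
        rw [e]; exact (hI.const_mul _).add (hIπ.const_mul _)
    _ = A * M + B * Z := by
        rw [hM, hZ, ← integral_const_mul, ← integral_const_mul, ← integral_add (hI.const_mul _) (hIπ.const_mul _)]
        exact integral_congr_ae (Eventually.of_forall fun x => by ring)

end Weights

section Main

variable {ω₂ lam β γ : ℝ} (hω : 0 < ω₂) (hl : 0 ≤ lam) (hβ : 0 ≤ β) (hγ : 0 < γ) (hN : 0 < N)
  {T : ℝ} (hT : 0 < T) {F : PhaseSpace N → ℝ} (hF : ContDiff ℝ ∞ F) (hFc : HasCompactSupport F)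
include hω hl hβ hγ hN hT hF hFc

/-- **The energy estimate with the cutoffs `χ_R`, uniformly in `R ≥ 1`**: there is `C ≥ 0` with
`∫_{s₀}^{s₁} ∫ π χ_R² Γ(P_s F) dx ds ≤ C (1 + (s₁ - s₀))` for all `R ≥ 1` and `0 < s₀ ≤ s₁`. -/
theorem pinnedChain_energy_estimate_cutoff :
    ∃ C : ℝ, 0 ≤ C ∧ ∀ R : ℝ, 1 ≤ R → ∀ s₀ s₁ : ℝ, 0 < s₀ → s₀ ≤ s₁ →
      ∫ s in s₀..s₁, ∫ x, (pinnedChain ω₂ lam β γ).gibbsDensity N T x *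
        (smoothCutoff ((pinnedChain ω₂ lam β γ).hamiltonian N x / R) ^ 2 *
          carreDuChamp ((pinnedChain ω₂ lam β γ).bathVecL N T) ((pinnedChain ω₂ lam β γ).bathVecR N T)
            (fun z => ∫ y, F y ∂((pinnedChain ω₂ lam β γ).transitionKernel N T T s.toNNReal z))
            (fun z => ∫ y, F y ∂((pinnedChain ω₂ lam β γ).transitionKernel N T T s.toNNReal z)) x) ≤
        C * (1 + (s₁ - s₀)) := by
  obtain ⟨CF, hCF⟩ : ∃ C, ∀ y, ‖F y‖ ≤ C := hF.continuous.bounded_above_of_compact_support hFc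
  have hCF' : ∀ y, |F y| ≤ CF := fun y => by rw [← Real.norm_eq_abs]; exact hCF y
  obtain ⟨D, hD0, hD⟩ := pinnedChain_integral_gibbs_cutoffWeight_le hω hl hβ hγ hN hT
  set Z := ∫ x, (pinnedChain ω₂ lam β γ).gibbsDensity N T x with hZ
  have hZ0 : 0 ≤ Z := integral_nonneg fun x => ((pinnedChain ω₂ lam β γ).gibbsDensity_pos N T x).le
  have hIπ := pinnedChain_integrable_gibbsDensity hω hl hβ γ N hT
  refine ⟨2 * CF ^ 2 * max Z D, mul_nonneg (by positivity) (le_max_of_le_left hZ0), fun R hR s₀ s₁ hs₀ hs₀₁ => ?_⟩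
  have hR0 : 0 < R := by linarith
  have h := pinnedChain_energy_estimate hω hl hβ hγ hN hT hF hFc (pinnedChain_contDiff_cutoff N γ R)
    (pinnedChain_hasCompactSupport_cutoff hω hl hβ N γ hR0) hCF' hs₀ hs₀₁
  refine h.trans ?_
  have h1 : ∫ x, (pinnedChain ω₂ lam β γ).gibbsDensity N T x *
      smoothCutoff ((pinnedChain ω₂ lam β γ).hamiltonian N x / R) ^ 2 ≤ Z := by
    rw [hZ]
    refine integral_mono_of_nonneg (Eventually.of_forall fun x => mul_nonneg
      ((pinnedChain ω₂ lam β γ).gibbsDensity_pos N T x).le (sq_nonneg _)) hIπ (Eventually.of_forall fun x => ?_)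
    have hc1 : smoothCutoff ((pinnedChain ω₂ lam β γ).hamiltonian N x / R) ^ 2 ≤ 1 := by
      have := smoothCutoff_le_one ((pinnedChain ω₂ lam β γ).hamiltonian N x / R)
      have := smoothCutoff_nonneg ((pinnedChain ω₂ lam β γ).hamiltonian N x / R)
      nlinarith
    simpa using mul_le_mul_of_nonneg_left hc1 ((pinnedChain ω₂ lam β γ).gibbsDensity_pos N T x).le
  have h2 := hD R hR
  have hs : 0 ≤ s₁ - s₀ := by linarith
  have hmax1 : Z ≤ max Z D := le_max_left _ _
  have hmax2 : D ≤ max Z D := le_max_right _ _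
  have hCF2 : 0 ≤ CF ^ 2 := sq_nonneg _
  have k1 : CF ^ 2 * ∫ x, (pinnedChain ω₂ lam β γ).gibbsDensity N T x *
      smoothCutoff ((pinnedChain ω₂ lam β γ).hamiltonian N x / R) ^ 2 ≤ CF ^ 2 * max Z D :=
    mul_le_mul_of_nonneg_left (h1.trans hmax1) hCF2
  have k2 := mul_le_mul_of_nonneg_left (mul_le_mul_of_nonneg_left (h2.trans hmax2) hCF2) hs
  calc 2 * (CF ^ 2 * (∫ x, (pinnedChain ω₂ lam β γ).gibbsDensity N T x *
        smoothCutoff ((pinnedChain ω₂ lam β γ).hamiltonian N x / R) ^ 2) +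
        (s₁ - s₀) * (CF ^ 2 * ∫ x, (pinnedChain ω₂ lam β γ).gibbsDensity N T x *
          |8 * carreDuChamp ((pinnedChain ω₂ lam β γ).bathVecL N T) ((pinnedChain ω₂ lam β γ).bathVecR N T)
              (fun y => smoothCutoff ((pinnedChain ω₂ lam β γ).hamiltonian N y / R))
              (fun y => smoothCutoff ((pinnedChain ω₂ lam β γ).hamiltonian N y / R)) x -
            (pinnedChain ω₂ lam β γ).generator N T T
              (fun y => smoothCutoff ((pinnedChain ω₂ lam β γ).hamiltonian N y / R) ^ 2) x|)) ≤
      2 * (CF ^ 2 * max Z D + (s₁ - s₀) * (CF ^ 2 * max Z D)) := by linarith [k1, k2]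
    _ = 2 * CF ^ 2 * max Z D * (1 + (s₁ - s₀)) := by ring

end Main

end Summit.AtomisticToContinuum.FouriersLaw.Theorems

end
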